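import Literature.Geometry.Lorentzian.TeukolskyRadialFluxInfinity
import HarnessLib

/-!
# The Jost decomposition at infinity of a scalar radial Teukolsky solution:
# `R = A·R_𝓘 + B·R̄_𝓘`, `|𝔚(R, R_𝓘)| = 2|ω||B|`, flux `ω(|A|² − |B|²)`
# (Teixeira da Costa 2020, Prop. 2.20; DRSR 2014, §5.3)

Companion of `TeukolskyRadialFlux.lean` / `TeukolskyRadialFluxInfinity.lean` (R. Teixeira da
Costa, Commun. Math. Phys. 378 (2020) 705–781 = arXiv:1910.02854 [Costa2019]; M. Dafermos,
I. Rodnianski, Y. Shlapentokh-Rothman, arXiv:1402.7034 [DafermosRodnianskiShlapentokhrothman2014]).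
For spin `s = 0` and real `(ω, m, λ)` the homogeneous radial Teukolsky ODE
(`Kerr.IsRadialTeukolskySolution M a 0 ω m λ`) has real coefficients, so together with a solution
`R_𝓘` normalised at `𝓘⁺` (Def. 2.3, `Kerr.IsNormalisedInfinitySolution M 0 ω R_𝓘`, "`∼ e^{iωr*}`")
its conjugate `R̄_𝓘` ("`∼ e^{−iωr*}`") is a second solution of the SAME equation
(`Costa2019.isRadialTeukolskySolution_conj`). For `M > 0`, `|a| < M`, `ω ≠ 0` the two are
independent — their Wronskian is `𝔚(R̄_𝓘, R_𝓘) = Δ(R̄_𝓘 R_𝓘′ − R_𝓘 R̄_𝓘′) = 2i·Δ·Im(R̄_𝓘 R_𝓘′) = 2iω`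
by the `𝓘⁺` flux `Δ·Im(R̄_𝓘 R_𝓘′) ≡ ω` (`Costa2019.radialFlux_eq_of_normalisedInfinity`) — and every
classical solution `R` on `(r₊, ∞)` is a constant-coefficient combination ("Jost decomposition",
TdC Prop. 2.20: `u_𝓗 = a_{𝓘⁺} u_𝓘 + a_{𝓘⁻} ū_𝓘` at `𝓘⁺`; `B = a_{𝓘⁻}` is the incoming, `A = a_{𝓘⁺}`
the outgoing amplitude). This file proves:

* `Costa2019.radialWronskian_conj_self_eq`, `Costa2019.norm_radialWronskian_conj_self` —
  `𝔚(R̄_𝓘, R_𝓘)(r) = 2iω`, `|𝔚(R̄_𝓘, R_𝓘)(r)| = 2|ω|` for every `r > r₊`;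
* `Costa2019.radial_sub_combination_of_data` — linearity of the ODE in witness form
  (`R − A R₁ − B R₂` solves, with the corresponding derivatives);
* `Costa2019.exists_jost_repr` — `∃ A B`, `R = A R_𝓘 + B R̄_𝓘` AND `R′ = A R_𝓘′ + B conj(R_𝓘′)` on
  `(r₊, ∞)` (Cramer at a radius `r₀ > r₊`, then uniqueness `Costa2019.radial_eq_zero_of_data`);
* `Costa2019.exists_jostDecomposition` — the decomposition together with its bookkeeping:
  `𝔚(R, R_𝓘) = B·𝔚(R̄_𝓘, R_𝓘)`, `|𝔚(R, R_𝓘)| = 2|ω||B|`, and the flux of `R` is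
  `Δ·Im(R̄ R′) = ω(|A|² − |B|²)` (the cross terms `A B̄ R_𝓘 R_𝓘′ + c.c.` have no imaginary part);
* `Costa2019.jost_normalisedHorizon` — for `R = R_𝓗` normalised at `𝓗⁺`, whose flux is
  `−(ω − mω₊)` (`Costa2019.radialFlux_eq_of_normalisedHorizon`): `ω(|B|² − |A|²) = ω − mω₊`
  (TdC Prop. 2.20: `ω²|a_{𝓘⁻}|² − ω²|a_{𝓘⁺}|² = ω(ω − mω₊)`; "superradiant iff `|A| > |B|`").

Not here: uniqueness of `(A, B)` as a separate statement (it is implicit: `B = 𝔚(R, R_𝓘)/(2iω)`),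
the `s ≠ 0` analogue (Teukolsky–Starobinsky), the extremal case `|a| = M`. Everything is proved;
theorems only.

## References
* R. Teixeira da Costa, CMP 378 (2020) 705–781 = arXiv:1910.02854: Def. 2.3, §2.4.1,
  Proposition 2.20, Remark 5.1. [Costa2019]
* M. Dafermos, I. Rodnianski, Y. Shlapentokh-Rothman, *Decay for solutions of the wave equation on
  Kerr exterior spacetimes III*, arXiv:1402.7034: §5.3 (`u′ − iωu = 0` at `r = ∞`,
  `u′ + i(ω − mω₊)u = 0` at `r₊`; transmission / reflection coefficients), §7.2 (`Q^T`).
  [DafermosRodnianskiShlapentokhrothman2014]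
* P. Hartman, *Ordinary Differential Equations*, SIAM Classics 38 (2002), Ch. IV §1 (solution
  space of a linear second-order ODE is two-dimensional). [Hartman2002]
-/

noncomputable section

open Complex
open scoped ComplexConjugate

namespace Literature.Geometry.Lorentzian.Kerr

namespace Costa2019

/-! ### `𝔚(R̄_𝓘, R_𝓘) = 2iω` -/

/-- `z̄ w − z w̄ = 2i · Im(z̄ w)`. [folklore] -/
private theorem conj_mul_sub_mul_conj_eq (z w : ℂ) :
    conj z * w - z * conj w = 2 * I * ((conj z * w).im : ℂ) := by
  apply Complex.ext
  · simp
  · simp; ring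

/-- `2iω ≠ 0` for real `ω ≠ 0`. [folklore] -/
private theorem two_mul_I_mul_ne_zero {ω : ℝ} (hω : ω ≠ 0) : (2 * I * (ω : ℂ)) ≠ 0 :=
  mul_ne_zero (mul_ne_zero two_ne_zero I_ne_zero) (Complex.ofReal_ne_zero.2 hω)

/-- **The Wronskian of `R̄_𝓘` and `R_𝓘` is `2iω`** (`s = 0`, `M > 0`, `|a| < M`, `ω ≠ 0`): for a
classical radial solution `R_𝓘` normalised at `𝓘⁺`,
`𝔚(R̄_𝓘, R_𝓘)(r) = Δ·(R̄_𝓘 R_𝓘′ − R_𝓘 R̄_𝓘′)(r) = 2i·Δ·Im(R̄_𝓘 R_𝓘′)(r) = 2iω` at every `r > r₊`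
(the `𝓘⁺` flux `Δ·Im(R̄_𝓘 R_𝓘′) ≡ ω`; TdC: `𝔚(ū_𝓘, u_𝓘) = 2iω`, the normalisation of the basis
`u_𝓘 ∼ e^{iωr*}`, `ū_𝓘 ∼ e^{−iωr*}` at `𝓘⁺`). [cite: Costa2019, Proposition 2.20] -/
theorem radialWronskian_conj_self_eq {M a ω m lam : ℝ} (hM : 0 < M) (ha : |a| < M) (hω : ω ≠ 0)
    {RI : ℝ → ℂ} (hI : IsRadialTeukolskySolution M a 0 ω m lam RI)
    (hnI : IsNormalisedInfinitySolution M 0 ω RI) {r : ℝ} (hr : rPlus M a < r) :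
    radialWronskian M a 0 (fun y ↦ conj (RI y)) RI r = 2 * I * ω := by
  have hflux := radialFlux_eq_of_normalisedInfinity hM ha hω hI hnI hr
  obtain ⟨RI', RI'', hRI⟩ := hI
  rw [radialWronskian_apply, deriv_conj_eq (hRI r hr).1, conj_mul_sub_mul_conj_eq, add_zero,
    Real.rpow_one, ← hflux]
  push_cast
  ring

/-- **`|𝔚(R̄_𝓘, R_𝓘)| = 2|ω|`** on `(r₊, ∞)` for `R_𝓘` normalised at `𝓘⁺` (`s = 0`, `M > 0`,
`|a| < M`, `ω ≠ 0`). [cite: Costa2019, Proposition 2.20] -/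
theorem norm_radialWronskian_conj_self {M a ω m lam : ℝ} (hM : 0 < M) (ha : |a| < M) (hω : ω ≠ 0)
    {RI : ℝ → ℂ} (hI : IsRadialTeukolskySolution M a 0 ω m lam RI)
    (hnI : IsNormalisedInfinitySolution M 0 ω RI) {r : ℝ} (hr : rPlus M a < r) :
    ‖radialWronskian M a 0 (fun y ↦ conj (RI y)) RI r‖ = 2 * |ω| := by
  rw [radialWronskian_conj_self_eq hM ha hω hI hnI hr, norm_mul, norm_mul, Complex.norm_I, mul_one,
    Complex.norm_ofNat, Complex.norm_real, Real.norm_eq_abs]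

/-! ### Linearity of the radial ODE (witness form) -/

/-- **Linear combinations of classical radial solutions (witness form).** If `R`, `R₁`, `R₂`
solve the homogeneous radial Teukolsky ODE on `(r₊, ∞)` with the displayed first and second
derivatives, then so does `R − A·R₁ − B·R₂` for any constants `A`, `B`, with the corresponding
combinations of the derivatives (the equation is linear and homogeneous). [folklore] -/
theorem radial_sub_combination_of_data {M a s ω m lam : ℝ}
    {R R' R'' R₁ R₁' R₁'' R₂ R₂' R₂'' : ℝ → ℂ}
    (hR : ∀ r : ℝ, rPlus M a < r →
      HasDerivAt R (R' r) r ∧ HasDerivAt R' (R'' r) r ∧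
        (delta M a r : ℂ) * R'' r + 2 * ((s + 1 : ℝ) : ℂ) * ((r - M : ℝ) : ℂ) * R' r +
          ((((radialK a ω m r ^ 2 : ℝ) : ℂ) -
                2 * I * (s : ℂ) * ((r - M : ℝ) : ℂ) * (radialK a ω m r : ℂ)) / (delta M a r : ℂ) +
              4 * I * (s : ℂ) * (ω : ℂ) * (r : ℂ) - (lam : ℂ) - ((a ^ 2 * ω ^ 2 : ℝ) : ℂ) +
              ((2 * a * m * ω : ℝ) : ℂ)) * R r = 0)
    (h₁ : ∀ r : ℝ, rPlus M a < r →
      HasDerivAt R₁ (R₁' r) r ∧ HasDerivAt R₁' (R₁'' r) r ∧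
        (delta M a r : ℂ) * R₁'' r + 2 * ((s + 1 : ℝ) : ℂ) * ((r - M : ℝ) : ℂ) * R₁' r +
          ((((radialK a ω m r ^ 2 : ℝ) : ℂ) -
                2 * I * (s : ℂ) * ((r - M : ℝ) : ℂ) * (radialK a ω m r : ℂ)) / (delta M a r : ℂ) +
              4 * I * (s : ℂ) * (ω : ℂ) * (r : ℂ) - (lam : ℂ) - ((a ^ 2 * ω ^ 2 : ℝ) : ℂ) +
              ((2 * a * m * ω : ℝ) : ℂ)) * R₁ r = 0)
    (h₂ : ∀ r : ℝ, rPlus M a < r →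
      HasDerivAt R₂ (R₂' r) r ∧ HasDerivAt R₂' (R₂'' r) r ∧
        (delta M a r : ℂ) * R₂'' r + 2 * ((s + 1 : ℝ) : ℂ) * ((r - M : ℝ) : ℂ) * R₂' r +
          ((((radialK a ω m r ^ 2 : ℝ) : ℂ) -
                2 * I * (s : ℂ) * ((r - M : ℝ) : ℂ) * (radialK a ω m r : ℂ)) / (delta M a r : ℂ) +
              4 * I * (s : ℂ) * (ω : ℂ) * (r : ℂ) - (lam : ℂ) - ((a ^ 2 * ω ^ 2 : ℝ) : ℂ) +
              ((2 * a * m * ω : ℝ) : ℂ)) * R₂ r = 0)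
    (A B : ℂ) :
    ∀ r : ℝ, rPlus M a < r →
      HasDerivAt (fun y => R y - A * R₁ y - B * R₂ y) (R' r - A * R₁' r - B * R₂' r) r ∧
        HasDerivAt (fun y => R' y - A * R₁' y - B * R₂' y) (R'' r - A * R₁'' r - B * R₂'' r) r ∧
        (delta M a r : ℂ) * (R'' r - A * R₁'' r - B * R₂'' r) +
            2 * ((s + 1 : ℝ) : ℂ) * ((r - M : ℝ) : ℂ) * (R' r - A * R₁' r - B * R₂' r) +
          ((((radialK a ω m r ^ 2 : ℝ) : ℂ) -
                2 * I * (s : ℂ) * ((r - M : ℝ) : ℂ) * (radialK a ω m r : ℂ)) / (delta M a r : ℂ) +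
              4 * I * (s : ℂ) * (ω : ℂ) * (r : ℂ) - (lam : ℂ) - ((a ^ 2 * ω ^ 2 : ℝ) : ℂ) +
              ((2 * a * m * ω : ℝ) : ℂ)) * (R r - A * R₁ r - B * R₂ r) = 0 := by
  intro r hr
  obtain ⟨d1, d2, e⟩ := hR r hr
  obtain ⟨d1₁, d2₁, e₁⟩ := h₁ r hr
  obtain ⟨d1₂, d2₂, e₂⟩ := h₂ r hr
  exact ⟨(d1.sub (d1₁.const_mul A)).sub (d1₂.const_mul B),
    (d2.sub (d2₁.const_mul A)).sub (d2₂.const_mul B), by linear_combination e - A * e₁ - B * e₂⟩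

/-! ### The Jost decomposition `R = A·R_𝓘 + B·R̄_𝓘` -/

/-- **Jost decomposition at infinity, with derivatives** (`s = 0`, `M > 0`, `|a| < M`, `ω ≠ 0`):
if `R_𝓘` is a classical radial solution normalised at `𝓘⁺` and `R` is any classical solution of
the same scalar radial ODE, there are constants `A`, `B` with `R = A·R_𝓘 + B·R̄_𝓘` and
`R′ = A·R_𝓘′ + B·conj(R_𝓘′)` on `(r₊, ∞)` (`R_𝓘`, `R̄_𝓘` form a basis of the two-dimensional
solution space since `𝔚(R̄_𝓘, R_𝓘) = 2iω ≠ 0`: solve for `A`, `B` at `r₀ = r₊ + 1` by Cramer's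
rule; `R − A R_𝓘 − B R̄_𝓘` then has vanishing data at `r₀`, hence vanishes identically).
[cite: Costa2019, Proposition 2.20] -/
theorem exists_jost_repr {M a ω m lam : ℝ} (hM : 0 < M) (ha : |a| < M) (hω : ω ≠ 0)
    {R RI : ℝ → ℂ} (hR : IsRadialTeukolskySolution M a 0 ω m lam R)
    (hI : IsRadialTeukolskySolution M a 0 ω m lam RI) (hnI : IsNormalisedInfinitySolution M 0 ω RI) :
    ∃ A B : ℂ, ∀ r, rPlus M a < r →
      R r = A * RI r + B * conj (RI r) ∧ deriv R r = A * deriv RI r + B * conj (deriv RI r) := by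
  -- a base point `r₀ > r₊`
  obtain ⟨r₀, h₀⟩ : ∃ r₀, rPlus M a < r₀ := ⟨rPlus M a + 1, lt_add_one _⟩
  have hW := radialWronskian_conj_self_eq hM ha hω hI hnI h₀
  obtain ⟨R', R'', hRw⟩ := hR
  obtain ⟨RI', RI'', hIw⟩ := hI
  obtain ⟨RJ', RJ'', hJw⟩ := isRadialTeukolskySolution_conj ⟨RI', RI'', hIw⟩
  -- the derivative witness of `R̄_𝓘` is `conj R_𝓘′`
  have hJ' : ∀ r, rPlus M a < r → RJ' r = conj (RI' r) := fun r hr => by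
    rw [← (hJw r hr).1.deriv, deriv_conj_eq (hIw r hr).1, (hIw r hr).1.deriv]
  -- the basis determinant at `r₀` does not vanish (`𝔚(R̄_𝓘, R_𝓘)(r₀) = 2iω ≠ 0`)
  have hdne : conj (RI r₀) * RI' r₀ - RI r₀ * RJ' r₀ ≠ 0 := by
    intro h0
    rw [radialWronskian_apply, (hIw _ h₀).1.deriv, (hJw _ h₀).1.deriv, h0, mul_zero] at hW
    exact two_mul_I_mul_ne_zero hω hW.symm
  -- Cramer's rule at `r₀`
  obtain ⟨A, hA⟩ : ∃ A : ℂ,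
      A = (conj (RI r₀) * R' r₀ - R r₀ * RJ' r₀) / (conj (RI r₀) * RI' r₀ - RI r₀ * RJ' r₀) :=
    ⟨_, rfl⟩
  obtain ⟨B, hB⟩ : ∃ B : ℂ,
      B = (RI' r₀ * R r₀ - RI r₀ * R' r₀) / (conj (RI r₀) * RI' r₀ - RI r₀ * RJ' r₀) :=
    ⟨_, rfl⟩
  have hS0 : R r₀ - A * RI r₀ - B * conj (RI r₀) = 0 := by
    rw [hA, hB, div_mul_eq_mul_div, div_mul_eq_mul_div, sub_sub, ← add_div, sub_eq_zero,
      eq_div_iff hdne]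
    ring
  have hS1 : R' r₀ - A * RI' r₀ - B * RJ' r₀ = 0 := by
    rw [hA, hB, div_mul_eq_mul_div, div_mul_eq_mul_div, sub_sub, ← add_div, sub_eq_zero,
      eq_div_iff hdne]
    ring
  -- `S := R − A R_𝓘 − B R̄_𝓘` solves with zero data at `r₀`, hence vanishes on `(r₊, ∞)`
  have hS := radial_sub_combination_of_data hRw hIw hJw A B
  have hzero := radial_eq_zero_of_data ha.le hS h₀ hS0 hS1
  refine ⟨A, B, fun r hr => ?_⟩
  obtain ⟨e0, e1⟩ := hzero r hr
  refine ⟨by linear_combination e0, ?_⟩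
  rw [(hRw r hr).1.deriv, (hIw r hr).1.deriv, ← hJ' r hr]
  linear_combination e1

/-- `Im( conj(A u + B ū)·(A u′ + B conj u′) ) = (|A|² − |B|²)·Im(ū u′)`: the cross terms
`A B̄ u u′ + Ā B ū conj(u′)` are complex conjugates of each other. [folklore] -/
private theorem im_conj_combination_mul (A B u u' : ℂ) :
    (conj (A * u + B * conj u) * (A * u' + B * conj u')).im =
      (‖A‖ ^ 2 - ‖B‖ ^ 2) * (conj u * u').im := by
  simp only [Complex.mul_im, Complex.mul_re, Complex.add_re, Complex.add_im, map_add, map_mul,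
    Complex.conj_conj, Complex.conj_re, Complex.conj_im, Complex.sq_norm, Complex.normSq_apply]
  ring

/-- **Jost decomposition at infinity and its bookkeeping** (TdC Prop. 2.20, `s = 0`, `M > 0`,
`|a| < M`, `ω ≠ 0`). For a classical radial solution `R_𝓘` normalised at `𝓘⁺` and any classical
solution `R` of the same scalar radial ODE there are constants `A` (outgoing amplitude, TdC's
`a_{𝓘⁺}`) and `B` (incoming amplitude, `a_{𝓘⁻}`) such that on `(r₊, ∞)`:
`R = A·R_𝓘 + B·R̄_𝓘`; `𝔚(R, R_𝓘) = B·𝔚(R̄_𝓘, R_𝓘)` (bilinearity, `𝔚(R_𝓘, R_𝓘) = 0`);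
`|𝔚(R̄_𝓘, R_𝓘)| = 2|ω|`; hence `|𝔚(R, R_𝓘)| = 2|ω|·|B|`; and the conserved flux of `R` is
`Δ·Im(R̄ R′) = ω(|A|² − |B|²)` (the cross terms cancel, `Δ·Im(R̄_𝓘 R_𝓘′) = ω`).
[cite: Costa2019, Proposition 2.20] -/
theorem exists_jostDecomposition {M a ω m lam : ℝ} (hM : 0 < M) (ha : |a| < M) (hω : ω ≠ 0)
    {R RI : ℝ → ℂ} (hR : IsRadialTeukolskySolution M a 0 ω m lam R)
    (hI : IsRadialTeukolskySolution M a 0 ω m lam RI) (hnI : IsNormalisedInfinitySolution M 0 ω RI) :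
    ∃ A B : ℂ,
      (∀ r, rPlus M a < r → R r = A * RI r + B * conj (RI r)) ∧
      (∀ r, rPlus M a < r →
        radialWronskian M a 0 R RI r = B * radialWronskian M a 0 (fun y ↦ conj (RI y)) RI r) ∧
      (∀ r, rPlus M a < r → ‖radialWronskian M a 0 (fun y ↦ conj (RI y)) RI r‖ = 2 * |ω|) ∧
      (∀ r, rPlus M a < r → ‖radialWronskian M a 0 R RI r‖ = 2 * |ω| * ‖B‖) ∧
      (∀ r, rPlus M a < r →
        delta M a r * (conj (R r) * deriv R r).im = ω * (‖A‖ ^ 2 - ‖B‖ ^ 2)) := by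
  obtain ⟨A, B, hAB⟩ := exists_jost_repr hM ha hω hR hI hnI
  obtain ⟨RI', RI'', hIw⟩ := id hI
  have hWB : ∀ r, rPlus M a < r →
      radialWronskian M a 0 R RI r = B * radialWronskian M a 0 (fun y ↦ conj (RI y)) RI r := by
    intro r hr
    obtain ⟨e0, e1⟩ := hAB r hr
    rw [radialWronskian_apply, radialWronskian_apply, deriv_conj_eq (hIw r hr).1, e0, e1]
    ring
  refine ⟨A, B, fun r hr => (hAB r hr).1, hWB,
    fun r hr => norm_radialWronskian_conj_self hM ha hω hI hnI hr, fun r hr => ?_, fun r hr => ?_⟩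
  · rw [hWB r hr, norm_mul, norm_radialWronskian_conj_self hM ha hω hI hnI hr]
    ring
  · obtain ⟨e0, e1⟩ := hAB r hr
    rw [e0, e1, im_conj_combination_mul, ← radialFlux_eq_of_normalisedInfinity hM ha hω hI hnI hr]
    ring

/-- **Jost decomposition of the horizon-normalised solution** (TdC Prop. 2.20, `s = 0`, `M > 0`,
`|a| < M`, `ω ≠ 0`): for `R_𝓗` normalised at `𝓗⁺` and `R_𝓘` normalised at `𝓘⁺`, both classical
solutions of the scalar radial ODE, `R_𝓗 = A·R_𝓘 + B·R̄_𝓘` on `(r₊, ∞)` with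
`|𝔚(R_𝓗, R_𝓘)| = 2|ω|·|B|` and the energy identity `ω(|B|² − |A|²) = ω − mω₊` (the flux of `R_𝓗`
is `−(ω − mω₊)` at `𝓗⁺` and `ω(|A|² − |B|²)` at `𝓘⁺`; TdC:
`ω²|a_{𝓘⁻}|² = ω²|a_{𝓘⁺}|² + ω(ω − mω₊)|a_{𝓗⁺}|²` with `a_{𝓗⁺} = 1`, `a_{𝓗⁻} = 0`; superradiance,
`|A| > |B|`, iff `ω(ω − mω₊) < 0`). [cite: Costa2019, Proposition 2.20] -/
theorem jost_normalisedHorizon {M a ω m lam : ℝ} (hM : 0 < M) (ha : |a| < M) (hω : ω ≠ 0)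
    {RH RI : ℝ → ℂ} (hH : IsRadialTeukolskySolution M a 0 ω m lam RH)
    (hnH : IsNormalisedHorizonSolution M a 0 ω m RH)
    (hI : IsRadialTeukolskySolution M a 0 ω m lam RI) (hnI : IsNormalisedInfinitySolution M 0 ω RI) :
    ∃ A B : ℂ,
      (∀ r, rPlus M a < r → RH r = A * RI r + B * conj (RI r)) ∧
      (∀ r, rPlus M a < r → ‖radialWronskian M a 0 RH RI r‖ = 2 * |ω| * ‖B‖) ∧
      ω * (‖B‖ ^ 2 - ‖A‖ ^ 2) = ω - m * horizonAngularVelocity M a := by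
  obtain ⟨A, B, hrep, -, -, hnorm, hflux⟩ := exists_jostDecomposition hM ha hω hH hI hnI
  have h₀ : rPlus M a < rPlus M a + 1 := lt_add_one _
  have hH₀ := radialFlux_eq_of_normalisedHorizon ha hH hnH h₀
  rw [hflux _ h₀] at hH₀
  exact ⟨A, B, hrep, hnorm, by linear_combination -hH₀⟩

end Costa2019

end Literature.Geometry.Lorentzian.Kerr

end
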